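import Summits.CriticalPhenomena.PercolationContinuityZ3.Theorems.Transplant.FKConnectivityAllQSPSections
import Summits.CriticalPhenomena.PercolationContinuityZ3.Theorems.Transplant.FKConnectivityAllQSPMono
import HarnessLib

/-!
# Connectivity correlation inequalities for `φ_{w,q}`, every `q > 0` — file 14b: CONDITIONING ON THE CONNECTION OF THE TERMINALS
# OF A TWO-TERMINAL SERIES–PARALLEL NETWORK RAISES EVERY INCREASING EVENT (the induction)

Support file (`--supports stmt-CriticalPhenomena-4575`), FK sub-lane `prim-bschramm-fk-2` (gen 8) of the post-continuity
programme; builds on p205010 (kernel theorem, internal audit signed; external expert review pending).  No definitions, no named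
facts, no sorries; standard axioms.

For a network `E` with terminals `s, t`, weights `w`, `q > 0` and an INCREASING event `F` (an upper set of configurations), write
(network masses `FK.netMass` of `…AllQSPMassDefs.lean`, `C = {s ↔ t}` read on `ω ∩ E`)
  (UPC-net)  `NM(Cᶜ ∩ F)·NM(C) ≤ NM(C ∩ F)·NM(Cᶜ)`,
i.e. inside the network `φ(F | s ↔ t) ≥ φ(F | s ↮ t)`: conditioning on the connection of the terminals stochastically RAISES the
configuration (event-wise).  With `F = J_f` this is gen 7's (MONO) `C⁰D¹ ≤ C¹D⁰` (`FK.spMono_of_isTTSP`, Wagner's induction); the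
present file runs the same induction for an ARBITRARY increasing `F`, which is not local to one part of a composition:
* `FK.upcNet_edge` — the single edge; `FK.upcNet_secR_left` / `FK.upcNet_secR_right` — the induction hypothesis of one part,
  applied to the SECTIONS `F_b = {η | η ∪ b ∈ F}` of `F` at the configurations `b` of the other part and integrated (the section
  laws of `…AllQSPSections.lean`), compares the mixed masses `R(Cᶜ, A₂, F)·NM₁(C) ≤ R(C, A₂, F)·NM₁(Cᶜ)` (and symmetrically);
* `FK.upcNet_series` / `FK.upcNet_parallel` — the two composition steps: after the section laws both sides are sums of products and
  the comparison is TERMWISE (series: three terms; parallel: three terms, the doubly-connected block carrying the factor `q`, whose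
  sign is all that is used — so every `q > 0` is covered, exactly as in (MONO));
* **`FK.upcNet_of_isTTSP`** — (UPC-net) on every two-terminal series–parallel network `FK.IsTTSP E s t`, every `w`, every `q > 0`,
  every increasing `F`.
Consequences at the level of the random-cluster measure (`φ(x↔y)φ(F) ≤ φ({x↔y} ∩ F)` on TTSP supports for every `q > 0`; for
`0 < q < 1` SINGLE-EDGE NEGATIVE DEPENDENCE `φ(J_e ∩ F) ≤ φ(J_e)φ(F)` — negative association with a singleton block, Grimmett 2006
§3.9, Pemantle's negative regression dependence — at every edge of every support `E ∪ {st}`) are drawn in `…AllQSPNegDep.lean`.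
[cite: Grimmett2006, §3.8 Thm. (3.90)–(3.91) (pp. 61–62); §3.9 (pp. 63–64); Thm. (3.8)] [cite: Wagner2006, Thm. 5.8(d), §5.3]
-/

noncomputable section

namespace Summit.CriticalPhenomena.PercolationContinuityZ3.Theorems

namespace FK

open SimpleGraph Literature.Probability.LatticeModels Literature.Probability.Percolation
open Literature.Probability.Percolation.BHK2006 (weight weight_nonneg)
open Literature.Probability.Percolation.DecisionTree (ind ind_of_mem ind_of_not_mem ind_nonneg)
open Literature.Probability.Percolation.TwoAvoidanceSets (ind_mul_ind)
open scoped Classical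

variable {V : Type*} [Fintype V]

/-! ### The single edge -/

/-- **(UPC-net) for a single edge** `{st}`, `s ≠ t`, `q ≥ 0`: with the edge closed the configuration read on the network is
empty, so either `∅ ∈ F` (and then `F` is everything) or the left-hand side vanishes. [folklore] -/
theorem upcNet_edge (w : Sym2 V → unitInterval) {q : ℝ} (hq : 0 ≤ q) {s t : V} (hst : s ≠ t) {F : Set (BondConfig V)}
    (hF : IsUpperSet F) :
    netMass w q ({s(s, t)} : Set (Sym2 V)) ((openConn s t)ᶜ ∩ F) * netMass w q ({s(s, t)} : Set (Sym2 V)) (openConn s t) ≤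
      netMass w q ({s(s, t)} : Set (Sym2 V)) (openConn s t ∩ F) * netMass w q ({s(s, t)} : Set (Sym2 V)) (openConn s t)ᶜ := by
  by_cases h0 : (∅ : BondConfig V) ∈ F
  · have hF' : F = Set.univ := Set.eq_univ_of_forall fun η => hF (Set.empty_subset η) h0
    subst hF'
    rw [Set.inter_univ, Set.inter_univ, mul_comm]
  · have hz : netMass w q ({s(s, t)} : Set (Sym2 V)) ((openConn s t)ᶜ ∩ F) = 0 := by
      unfold netMass
      refine Finset.sum_eq_zero fun ω _ => ?_
      have h : ω ∩ {s(s, t)} ∉ (openConn s t)ᶜ ∩ F := by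
        rintro ⟨hc, hf⟩
        by_cases he : s(s, t) ∈ ω
        · have hmem : s(s, t) ∈ ω ∩ ({s(s, t)} : Set (Sym2 V)) := ⟨he, rfl⟩
          exact hc
            (SimpleGraph.Adj.reachable (G := openGraph (ω ∩ {s(s, t)})) ((SimpleGraph.fromEdgeSet_adj _).2 ⟨hmem, hst⟩))
        · have hem : ω ∩ ({s(s, t)} : Set (Sym2 V)) = ∅ := by
            ext g
            simp only [Set.mem_inter_iff, Set.mem_singleton_iff, Set.mem_empty_iff_false, iff_false, not_and]
            rintro hg rfl
            exact he hg
          rw [hem] at hf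
          exact h0 hf
      rw [ind_of_not_mem h, mul_zero, mul_zero]
    rw [hz, zero_mul]
    exact mul_nonneg (netMass_nonneg w hq _ _) (netMass_nonneg w hq _ _)

/-! ### The induction hypothesis of one part, integrated against the other -/

section Mixed

variable (w : Sym2 V → unitInterval) {q : ℝ} (hq : 0 ≤ q) (E₁ E₂ : Set (Sym2 V))
include hq

/-- **IH of the first part under the section law**: if (UPC-net) holds on `E₁` (terminals `s₁, t₁`) for every increasing event,
then for every event `A₂` of the second part and every increasing `F`,
`R(C₁ᶜ, A₂, F)·NM₁(C₁) ≤ R(C₁, A₂, F)·NM₁(C₁ᶜ)` (apply the hypothesis to the sections `F_b`, which are increasing, and sum).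
[cite: Grimmett2006, §3.8 (pp. 61–62)] -/
theorem upcNet_secR_left {s₁ t₁ : V}
    (ih : ∀ F' : Set (BondConfig V), IsUpperSet F' →
      netMass w q E₁ ((openConn s₁ t₁)ᶜ ∩ F') * netMass w q E₁ (openConn s₁ t₁) ≤
        netMass w q E₁ (openConn s₁ t₁ ∩ F') * netMass w q E₁ (openConn s₁ t₁)ᶜ)
    (A₂ : Set (BondConfig V)) {F : Set (BondConfig V)} (hF : IsUpperSet F) :
    (∑ ω' : BondConfig V, weight (fun e => (w e : ℝ)) ω' *
        (q ^ clusterCount (ω' ∩ E₂) ∅ * ind A₂ (ω' ∩ E₂) *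
          netMass w q E₁ ((openConn s₁ t₁)ᶜ ∩ {η | η ∪ (ω' ∩ E₂) ∈ F}))) * netMass w q E₁ (openConn s₁ t₁) ≤
      (∑ ω' : BondConfig V, weight (fun e => (w e : ℝ)) ω' *
        (q ^ clusterCount (ω' ∩ E₂) ∅ * ind A₂ (ω' ∩ E₂) *
          netMass w q E₁ (openConn s₁ t₁ ∩ {η | η ∪ (ω' ∩ E₂) ∈ F}))) * netMass w q E₁ (openConn s₁ t₁)ᶜ := by
  rw [Finset.sum_mul, Finset.sum_mul]
  refine Finset.sum_le_sum fun ω' _ => ?_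
  have hih := ih {η | η ∪ (ω' ∩ E₂) ∈ F} (isUpperSet_sec hF _)
  have hc : 0 ≤ weight (fun e => (w e : ℝ)) ω' * (q ^ clusterCount (ω' ∩ E₂) ∅ * ind A₂ (ω' ∩ E₂)) :=
    mul_nonneg (weight_nonneg (fun e => (coe_weights_mem w e).1) (fun e => (coe_weights_mem w e).2) ω')
      (mul_nonneg (pow_nonneg hq _) (ind_nonneg _ _))
  calc weight (fun e => (w e : ℝ)) ω' * (q ^ clusterCount (ω' ∩ E₂) ∅ * ind A₂ (ω' ∩ E₂) *
          netMass w q E₁ ((openConn s₁ t₁)ᶜ ∩ {η | η ∪ (ω' ∩ E₂) ∈ F})) * netMass w q E₁ (openConn s₁ t₁)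
      = (weight (fun e => (w e : ℝ)) ω' * (q ^ clusterCount (ω' ∩ E₂) ∅ * ind A₂ (ω' ∩ E₂))) *
          (netMass w q E₁ ((openConn s₁ t₁)ᶜ ∩ {η | η ∪ (ω' ∩ E₂) ∈ F}) * netMass w q E₁ (openConn s₁ t₁)) := by ring
    _ ≤ (weight (fun e => (w e : ℝ)) ω' * (q ^ clusterCount (ω' ∩ E₂) ∅ * ind A₂ (ω' ∩ E₂))) *
          (netMass w q E₁ (openConn s₁ t₁ ∩ {η | η ∪ (ω' ∩ E₂) ∈ F}) * netMass w q E₁ (openConn s₁ t₁)ᶜ) :=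
        mul_le_mul_of_nonneg_left hih hc
    _ = _ := by ring

/-- **IH of the second part under the section law**: if (UPC-net) holds on `E₂` (terminals `s₂, t₂`) for every increasing event,
then for every event `A₁` of the first part and every increasing `F`,
`R(A₁, C₂ᶜ, F)·NM₂(C₂) ≤ R(A₁, C₂, F)·NM₂(C₂ᶜ)` (swap the order of integration, then as `FK.upcNet_secR_left`).
[cite: Grimmett2006, §3.8 (pp. 61–62)] -/
theorem upcNet_secR_right {s₂ t₂ : V}
    (ih : ∀ F' : Set (BondConfig V), IsUpperSet F' →
      netMass w q E₂ ((openConn s₂ t₂)ᶜ ∩ F') * netMass w q E₂ (openConn s₂ t₂) ≤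
        netMass w q E₂ (openConn s₂ t₂ ∩ F') * netMass w q E₂ (openConn s₂ t₂)ᶜ)
    (A₁ : Set (BondConfig V)) {F : Set (BondConfig V)} (hF : IsUpperSet F) :
    (∑ ω' : BondConfig V, weight (fun e => (w e : ℝ)) ω' *
        (q ^ clusterCount (ω' ∩ E₂) ∅ * ind (openConn s₂ t₂)ᶜ (ω' ∩ E₂) *
          netMass w q E₁ (A₁ ∩ {η | η ∪ (ω' ∩ E₂) ∈ F}))) * netMass w q E₂ (openConn s₂ t₂) ≤
      (∑ ω' : BondConfig V, weight (fun e => (w e : ℝ)) ω' *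
        (q ^ clusterCount (ω' ∩ E₂) ∅ * ind (openConn s₂ t₂) (ω' ∩ E₂) *
          netMass w q E₁ (A₁ ∩ {η | η ∪ (ω' ∩ E₂) ∈ F}))) * netMass w q E₂ (openConn s₂ t₂)ᶜ := by
  rw [secR_swap, secR_swap, Finset.sum_mul, Finset.sum_mul]
  refine Finset.sum_le_sum fun ω _ => ?_
  have hih := ih {η | (ω ∩ E₁) ∪ η ∈ F} (isUpperSet_sec' hF _)
  have hc : 0 ≤ weight (fun e => (w e : ℝ)) ω * (q ^ clusterCount (ω ∩ E₁) ∅ * ind A₁ (ω ∩ E₁)) :=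
    mul_nonneg (weight_nonneg (fun e => (coe_weights_mem w e).1) (fun e => (coe_weights_mem w e).2) ω)
      (mul_nonneg (pow_nonneg hq _) (ind_nonneg _ _))
  calc weight (fun e => (w e : ℝ)) ω * (q ^ clusterCount (ω ∩ E₁) ∅ * ind A₁ (ω ∩ E₁) *
          netMass w q E₂ ((openConn s₂ t₂)ᶜ ∩ {η | (ω ∩ E₁) ∪ η ∈ F})) * netMass w q E₂ (openConn s₂ t₂)
      = (weight (fun e => (w e : ℝ)) ω * (q ^ clusterCount (ω ∩ E₁) ∅ * ind A₁ (ω ∩ E₁))) *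
          (netMass w q E₂ ((openConn s₂ t₂)ᶜ ∩ {η | (ω ∩ E₁) ∪ η ∈ F}) * netMass w q E₂ (openConn s₂ t₂)) := by ring
    _ ≤ (weight (fun e => (w e : ℝ)) ω * (q ^ clusterCount (ω ∩ E₁) ∅ * ind A₁ (ω ∩ E₁))) *
          (netMass w q E₂ (openConn s₂ t₂ ∩ {η | (ω ∩ E₁) ∪ η ∈ F}) * netMass w q E₂ (openConn s₂ t₂)ᶜ) :=
        mul_le_mul_of_nonneg_left hih hc
    _ = _ := by ring

omit hq in
/-- Splitting the section law along an event of the second part: `R(A₁, ⊤, F) = R(A₁, A₂, F) + R(A₁, A₂ᶜ, F)`. [folklore] -/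
theorem secR_split (A₁ A₂ F : Set (BondConfig V)) :
    ∑ ω' : BondConfig V, weight (fun e => (w e : ℝ)) ω' *
        (q ^ clusterCount (ω' ∩ E₂) ∅ * ind Set.univ (ω' ∩ E₂) * netMass w q E₁ (A₁ ∩ {η | η ∪ (ω' ∩ E₂) ∈ F})) =
      ∑ ω' : BondConfig V, weight (fun e => (w e : ℝ)) ω' *
          (q ^ clusterCount (ω' ∩ E₂) ∅ * ind A₂ (ω' ∩ E₂) * netMass w q E₁ (A₁ ∩ {η | η ∪ (ω' ∩ E₂) ∈ F})) +
        ∑ ω' : BondConfig V, weight (fun e => (w e : ℝ)) ω' *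
          (q ^ clusterCount (ω' ∩ E₂) ∅ * ind A₂ᶜ (ω' ∩ E₂) * netMass w q E₁ (A₁ ∩ {η | η ∪ (ω' ∩ E₂) ∈ F})) := by
  rw [← Finset.sum_add_distrib]
  refine Finset.sum_congr rfl fun ω' _ => ?_
  have h : ind Set.univ (ω' ∩ E₂) = ind A₂ (ω' ∩ E₂) + ind A₂ᶜ (ω' ∩ E₂) := by
    rw [ind_of_mem (Set.mem_univ _)]
    by_cases hA : ω' ∩ E₂ ∈ A₂
    · rw [ind_of_mem hA, ind_of_not_mem (show ω' ∩ E₂ ∉ A₂ᶜ from fun h => h hA)]; ring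
    · rw [ind_of_not_mem hA, ind_of_mem (show ω' ∩ E₂ ∈ A₂ᶜ from hA)]; ring
  rw [h]; ring

end Mixed

/-! ### The composition steps -/

section Steps

variable (w : Sym2 V → unitInterval) {q : ℝ} (hq : 0 < q) {E₁ E₂ : Set (Sym2 V)} {V₁ V₂ : Set V}
include hq

/-- **Series step**: (UPC-net) for `(E₁; a, m)` and for `(E₂; m, b)`, each for every increasing event, gives (UPC-net) for
`(E₁ ∪ E₂; a, b)` for every increasing event.  After the section laws the two sides are
`[R(C₁,C₂ᶜ,F) + R(C₁ᶜ,C₂,F) + R(C₁ᶜ,C₂ᶜ,F)]·N₁(C₁)N₂(C₂)` and `R(C₁,C₂,F)·[N₁(C₁)N₂(C₂ᶜ) + N₁(C₁ᶜ)N₂(C₂) + N₁(C₁ᶜ)N₂(C₂ᶜ)]`,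
compared term by term. [cite: Grimmett2006, §3.8 Thm. (3.90) (p. 61)] -/
theorem upcNet_series (hd : Disjoint E₁ E₂) (h₁ : ∀ e ∈ E₁, ∀ z ∈ e, z ∈ V₁) (h₂ : ∀ e ∈ E₂, ∀ z ∈ e, z ∈ V₂)
    {a m b : V} (hS : V₁ ∩ V₂ ⊆ {m}) (haV₂ : a ∉ V₂) (hbV₁ : b ∉ V₁) (ham : a ≠ m) (hbm : b ≠ m) (hab : a ≠ b)
    (ih₁ : ∀ F' : Set (BondConfig V), IsUpperSet F' →
      netMass w q E₁ ((openConn a m)ᶜ ∩ F') * netMass w q E₁ (openConn a m) ≤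
        netMass w q E₁ (openConn a m ∩ F') * netMass w q E₁ (openConn a m)ᶜ)
    (ih₂ : ∀ F' : Set (BondConfig V), IsUpperSet F' →
      netMass w q E₂ ((openConn m b)ᶜ ∩ F') * netMass w q E₂ (openConn m b) ≤
        netMass w q E₂ (openConn m b ∩ F') * netMass w q E₂ (openConn m b)ᶜ)
    {F : Set (BondConfig V)} (hF : IsUpperSet F) :
    netMass w q (E₁ ∪ E₂) ((openConn a b)ᶜ ∩ F) * netMass w q (E₁ ∪ E₂) (openConn a b) ≤
      netMass w q (E₁ ∪ E₂) (openConn a b ∩ F) * netMass w q (E₁ ∪ E₂) (openConn a b)ᶜ := by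
  have hX : 0 < q ^ Fintype.card V := pow_pos hq _
  -- the four masses of the composite
  have eCF := netMass_series_conn_sec w q hd h₁ h₂ hS haV₂ hbV₁ ham hbm hab F
  have eDF := netMass_series_disc_sec w q hd h₁ h₂ hS haV₂ hbV₁ ham hbm hab F
  have eC := netMass_series_conn w q hd h₁ h₂ hS haV₂ hbV₁ ham hbm hab (markLocal_univ E₁ E₂)
  have eD := netMass_series_disc w q hd h₁ h₂ hS haV₂ hbV₁ ham hbm hab (markLocal_univ E₁ E₂)
  simp only [Set.inter_univ] at eC eD
  rw [secR_split w E₁ E₂ (openConn a m)ᶜ (openConn m b) F] at eDF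
  -- abbreviations
  set RCC := ∑ ω' : BondConfig V, weight (fun e => (w e : ℝ)) ω' *
    (q ^ clusterCount (ω' ∩ E₂) ∅ * ind (openConn m b) (ω' ∩ E₂) *
      netMass w q E₁ (openConn a m ∩ {η | η ∪ (ω' ∩ E₂) ∈ F})) with hRCC
  set RCD := ∑ ω' : BondConfig V, weight (fun e => (w e : ℝ)) ω' *
    (q ^ clusterCount (ω' ∩ E₂) ∅ * ind (openConn m b)ᶜ (ω' ∩ E₂) *
      netMass w q E₁ (openConn a m ∩ {η | η ∪ (ω' ∩ E₂) ∈ F})) with hRCD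
  set RDC := ∑ ω' : BondConfig V, weight (fun e => (w e : ℝ)) ω' *
    (q ^ clusterCount (ω' ∩ E₂) ∅ * ind (openConn m b) (ω' ∩ E₂) *
      netMass w q E₁ ((openConn a m)ᶜ ∩ {η | η ∪ (ω' ∩ E₂) ∈ F})) with hRDC
  set RDD := ∑ ω' : BondConfig V, weight (fun e => (w e : ℝ)) ω' *
    (q ^ clusterCount (ω' ∩ E₂) ∅ * ind (openConn m b)ᶜ (ω' ∩ E₂) *
      netMass w q E₁ ((openConn a m)ᶜ ∩ {η | η ∪ (ω' ∩ E₂) ∈ F})) with hRDD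
  set N1C := netMass w q E₁ (openConn a m) with hN1C
  set N1D := netMass w q E₁ (openConn a m)ᶜ with hN1D
  set N2C := netMass w q E₂ (openConn m b) with hN2C
  set N2D := netMass w q E₂ (openConn m b)ᶜ with hN2D
  have hZ2 : netMass w q E₂ Set.univ = N2C + N2D := by
    rw [netMass_split w q E₂ Set.univ (openConn m b), Set.univ_inter, Set.univ_inter]
  rw [hZ2] at eD
  -- the induction hypotheses, integrated
  have k1 : RCD * N2C ≤ RCC * N2D := upcNet_secR_right w hq.le E₁ E₂ ih₂ (openConn a m) hF
  have k2 : RDC * N1C ≤ RCC * N1D := upcNet_secR_left w hq.le E₁ E₂ ih₁ (openConn m b) hF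
  have k3 : RDD * N1C ≤ RCD * N1D := upcNet_secR_left w hq.le E₁ E₂ ih₁ (openConn m b)ᶜ hF
  have hN1C : 0 ≤ N1C := netMass_nonneg w hq.le _ _
  have hN1D : 0 ≤ N1D := netMass_nonneg w hq.le _ _
  have hN2C : 0 ≤ N2C := netMass_nonneg w hq.le _ _
  have hN2D : 0 ≤ N2D := netMass_nonneg w hq.le _ _
  have t1 := mul_le_mul_of_nonneg_right k1 hN1C
  have t2 := mul_le_mul_of_nonneg_right k2 hN2C
  have t3a := mul_le_mul_of_nonneg_right k3 hN2C
  have t3b := mul_le_mul_of_nonneg_right k1 hN1D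
  have key : (q ^ Fintype.card V * netMass w q (E₁ ∪ E₂) ((openConn a b)ᶜ ∩ F)) *
      (q ^ Fintype.card V * netMass w q (E₁ ∪ E₂) (openConn a b)) ≤
      (q ^ Fintype.card V * netMass w q (E₁ ∪ E₂) (openConn a b ∩ F)) *
      (q ^ Fintype.card V * netMass w q (E₁ ∪ E₂) (openConn a b)ᶜ) := by
    rw [eCF, eDF, eC, eD]
    nlinarith [t1, t2, t3a, t3b]
  have hX2 : 0 < q ^ Fintype.card V * q ^ Fintype.card V := mul_pos hX hX
  nlinarith [key]

/-- **Parallel step**: (UPC-net) for `(E₁; s, t)` and for `(E₂; s, t)`, each for every increasing event, gives (UPC-net) for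
`(E₁ ∪ E₂; s, t)` for every increasing event.  After the section laws the two sides are
`R(Cᶜ,Cᶜ,F)·[N₁(C)N₂(Cᶜ) + N₁(Cᶜ)N₂(C) + q·N₁(C)N₂(C)]` and `[R(C,Cᶜ,F) + R(Cᶜ,C,F) + q·R(C,C,F)]·N₁(Cᶜ)N₂(Cᶜ)`, compared term
by term; only `q ≥ 0` is used. [cite: Grimmett2006, §3.8 Thm. (3.91) (p. 62)] [cite: Wagner2006, Thm. 5.8(d)] -/
theorem upcNet_parallel (hd : Disjoint E₁ E₂) (h₁ : ∀ e ∈ E₁, ∀ z ∈ e, z ∈ V₁) (h₂ : ∀ e ∈ E₂, ∀ z ∈ e, z ∈ V₂)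
    {s t : V} (hS : V₁ ∩ V₂ ⊆ {s, t}) (hst : s ≠ t)
    (ih₁ : ∀ F' : Set (BondConfig V), IsUpperSet F' →
      netMass w q E₁ ((openConn s t)ᶜ ∩ F') * netMass w q E₁ (openConn s t) ≤
        netMass w q E₁ (openConn s t ∩ F') * netMass w q E₁ (openConn s t)ᶜ)
    (ih₂ : ∀ F' : Set (BondConfig V), IsUpperSet F' →
      netMass w q E₂ ((openConn s t)ᶜ ∩ F') * netMass w q E₂ (openConn s t) ≤
        netMass w q E₂ (openConn s t ∩ F') * netMass w q E₂ (openConn s t)ᶜ)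
    {F : Set (BondConfig V)} (hF : IsUpperSet F) :
    netMass w q (E₁ ∪ E₂) ((openConn s t)ᶜ ∩ F) * netMass w q (E₁ ∪ E₂) (openConn s t) ≤
      netMass w q (E₁ ∪ E₂) (openConn s t ∩ F) * netMass w q (E₁ ∪ E₂) (openConn s t)ᶜ := by
  have hX : 0 < q ^ Fintype.card V := pow_pos hq _
  have eCF := netMass_parallel_conn_sec w q hd h₁ h₂ hS hst F
  have eDF := netMass_parallel_disc_sec w q hd h₁ h₂ hS hst F
  have eC := netMass_parallel_conn w q hd h₁ h₂ hS hst (markLocal_univ E₁ E₂)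
  have eD := netMass_parallel_disc w q hd h₁ h₂ hS hst (markLocal_univ E₁ E₂)
  simp only [Set.inter_univ] at eC eD
  set RCC := ∑ ω' : BondConfig V, weight (fun e => (w e : ℝ)) ω' *
    (q ^ clusterCount (ω' ∩ E₂) ∅ * ind (openConn s t) (ω' ∩ E₂) *
      netMass w q E₁ (openConn s t ∩ {η | η ∪ (ω' ∩ E₂) ∈ F})) with hRCC
  set RCD := ∑ ω' : BondConfig V, weight (fun e => (w e : ℝ)) ω' *
    (q ^ clusterCount (ω' ∩ E₂) ∅ * ind (openConn s t)ᶜ (ω' ∩ E₂) *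
      netMass w q E₁ (openConn s t ∩ {η | η ∪ (ω' ∩ E₂) ∈ F})) with hRCD
  set RDC := ∑ ω' : BondConfig V, weight (fun e => (w e : ℝ)) ω' *
    (q ^ clusterCount (ω' ∩ E₂) ∅ * ind (openConn s t) (ω' ∩ E₂) *
      netMass w q E₁ ((openConn s t)ᶜ ∩ {η | η ∪ (ω' ∩ E₂) ∈ F})) with hRDC
  set RDD := ∑ ω' : BondConfig V, weight (fun e => (w e : ℝ)) ω' *
    (q ^ clusterCount (ω' ∩ E₂) ∅ * ind (openConn s t)ᶜ (ω' ∩ E₂) *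
      netMass w q E₁ ((openConn s t)ᶜ ∩ {η | η ∪ (ω' ∩ E₂) ∈ F})) with hRDD
  set N1C := netMass w q E₁ (openConn s t) with hN1C
  set N1D := netMass w q E₁ (openConn s t)ᶜ with hN1D
  set N2C := netMass w q E₂ (openConn s t) with hN2C
  set N2D := netMass w q E₂ (openConn s t)ᶜ with hN2D
  have k1 : RDD * N1C ≤ RCD * N1D := upcNet_secR_left w hq.le E₁ E₂ ih₁ (openConn s t)ᶜ hF
  have k2 : RDD * N2C ≤ RDC * N2D := upcNet_secR_right w hq.le E₁ E₂ ih₂ (openConn s t)ᶜ hF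
  have k3 : RCD * N2C ≤ RCC * N2D := upcNet_secR_right w hq.le E₁ E₂ ih₂ (openConn s t) hF
  have hN1C : 0 ≤ N1C := netMass_nonneg w hq.le _ _
  have hN1D : 0 ≤ N1D := netMass_nonneg w hq.le _ _
  have hN2C : 0 ≤ N2C := netMass_nonneg w hq.le _ _
  have hN2D : 0 ≤ N2D := netMass_nonneg w hq.le _ _
  have t1 := mul_le_mul_of_nonneg_right k1 hN2D
  have t2 := mul_le_mul_of_nonneg_right k2 hN1D
  have t3a := mul_le_mul_of_nonneg_right k1 hN2C
  have t3b := mul_le_mul_of_nonneg_right k3 hN1D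
  have t3 : RDD * N1C * N2C ≤ RCC * N2D * N1D := le_trans t3a (by linarith [t3b])
  have t3q := mul_le_mul_of_nonneg_left t3 hq.le
  have key : (q ^ Fintype.card V * netMass w q (E₁ ∪ E₂) ((openConn s t)ᶜ ∩ F)) *
      (q ^ Fintype.card V * netMass w q (E₁ ∪ E₂) (openConn s t)) ≤
      (q ^ Fintype.card V * netMass w q (E₁ ∪ E₂) (openConn s t ∩ F)) *
      (q ^ Fintype.card V * netMass w q (E₁ ∪ E₂) (openConn s t)ᶜ) := by
    rw [eCF, eDF, eC, eD]
    nlinarith [t1, t2, t3q]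
  have hX2 : 0 < q ^ Fintype.card V * q ^ Fintype.card V := mul_pos hX hX
  nlinarith [key]

end Steps

/-! ### (UPC-net) on every two-terminal series–parallel network -/

/-- **Conditioning on the connection of the terminals raises every increasing event, inside every two-terminal series–parallel
network, for every `q > 0`**: for `FK.IsTTSP E s t`, every weight vector `w`, every `q > 0` and every upper set `F` of
configurations, `NM(Cᶜ ∩ F)·NM(C) ≤ NM(C ∩ F)·NM(Cᶜ)` with `C = {s ↔ t}` and the masses read on `ω ∩ E` under the product weight
with the cluster factor `q^{k(ω ∩ E)}` — i.e. `φ_E(F | s ↔ t) ≥ φ_E(F | s ↮ t)`.  (`F = J_f` is Wagner's (MONO), `FK.spMono_of_isTTSP`.)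
[cite: Grimmett2006, §3.8 Thm. (3.90)–(3.91) (pp. 61–62); §3.9 (pp. 63–64)] [cite: Wagner2006, Thm. 5.8(d), §5.3] -/
theorem upcNet_of_isTTSP (w : Sym2 V → unitInterval) {q : ℝ} (hq : 0 < q) {E : Finset (Sym2 V)} {s t : V}
    (h : IsTTSP E s t) :
    ∀ F : Set (BondConfig V), IsUpperSet F →
      netMass w q (↑E : Set (Sym2 V)) ((openConn s t)ᶜ ∩ F) * netMass w q (↑E : Set (Sym2 V)) (openConn s t) ≤
        netMass w q (↑E : Set (Sym2 V)) (openConn s t ∩ F) * netMass w q (↑E : Set (Sym2 V)) (openConn s t)ᶜ := by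
  induction h with
  | @edge s t hst =>
    intro F hF
    rw [Finset.coe_singleton]
    exact upcNet_edge w hq.le hst hF
  | @series E₁ E₂ a m b h₁ h₂ hd hV ha hb ih₁ ih₂ =>
    intro F hF
    rw [Finset.coe_union]
    have g₁ : ∀ e ∈ (↑E₁ : Set (Sym2 V)), ∀ z ∈ e, z ∈ {z : V | ∃ e ∈ E₁, z ∈ e} := fun e he z hz => ⟨e, he, hz⟩
    have g₂ : ∀ e ∈ (↑E₂ : Set (Sym2 V)), ∀ z ∈ e, z ∈ {z : V | ∃ e ∈ E₂, z ∈ e} := fun e he z hz => ⟨e, he, hz⟩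
    have gS : {z : V | ∃ e ∈ E₁, z ∈ e} ∩ {z : V | ∃ e ∈ E₂, z ∈ e} ⊆ ({m} : Set V) :=
      fun z hz => hV z hz.1 hz.2
    have gaV₂ : a ∉ {z : V | ∃ e ∈ E₂, z ∈ e} := fun ⟨e, he, hae⟩ => ha e he hae
    have gbV₁ : b ∉ {z : V | ∃ e ∈ E₁, z ∈ e} := fun ⟨e, he, hbe⟩ => hb e he hbe
    have gam : a ≠ m := by
      obtain ⟨e, he, hme⟩ := h₂.left_mem
      intro ham; exact ha e he (ham ▸ hme)
    have gbm : b ≠ m := by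
      obtain ⟨e, he, hme⟩ := h₁.right_mem
      intro hbm; exact hb e he (hbm ▸ hme)
    have gab : a ≠ b := by
      obtain ⟨e, he, hae⟩ := h₁.left_mem
      intro hab; exact hb e he (hab ▸ hae)
    have gd : Disjoint (↑E₁ : Set (Sym2 V)) ↑E₂ := Finset.disjoint_coe.2 hd
    exact upcNet_series w hq gd g₁ g₂ gS gaV₂ gbV₁ gam gbm gab ih₁ ih₂ hF
  | @parallel E₁ E₂ s t h₁ h₂ hd hV ih₁ ih₂ =>
    intro F hF
    rw [Finset.coe_union]
    have g₁ : ∀ e ∈ (↑E₁ : Set (Sym2 V)), ∀ z ∈ e, z ∈ {z : V | ∃ e ∈ E₁, z ∈ e} := fun e he z hz => ⟨e, he, hz⟩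
    have g₂ : ∀ e ∈ (↑E₂ : Set (Sym2 V)), ∀ z ∈ e, z ∈ {z : V | ∃ e ∈ E₂, z ∈ e} := fun e he z hz => ⟨e, he, hz⟩
    have gS : {z : V | ∃ e ∈ E₁, z ∈ e} ∩ {z : V | ∃ e ∈ E₂, z ∈ e} ⊆ ({s, t} : Set V) := by
      intro z hz
      rcases hV z hz.1 hz.2 with h | h
      · exact Or.inl h
      · exact Or.inr h
    have gst : s ≠ t := h₁.ne
    have gd : Disjoint (↑E₁ : Set (Sym2 V)) ↑E₂ := Finset.disjoint_coe.2 hd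
    exact upcNet_parallel w hq gd g₁ g₂ gS gst ih₁ ih₂ hF

end FK

end Summit.CriticalPhenomena.PercolationContinuityZ3.Theorems

end
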